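import Summits.HodgeConjecture.HodgeConjecture.Theorems.F0P2oK1occ
import Literature.RepresentationTheory.MoeglinVignerasWaldspurger1987.RankOneThetaDichotomy
import Literature.RepresentationTheory.CompactAbelianTypeDichotomyOfDisjoint
import Literature.NumberTheory.GelbartRogawski1991.LocalLineModelTransport
import Literature.NumberTheory.QuadraticForms.HasseMinkowskiTernaryLemmas
import Literature.NumberTheory.Weil1964.WeilGaussScalarMul
import HarnessLib

/-!
# Road (T) «UP THE TOWER», step (6a): the `e′_a` transport of rank-(1,1) line families to the δ-model of ★ `rankOne_theta_dichotomy`, and the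
# exact `(U(1), U(1))` dichotomy at the transported sections FROM DISJOINTNESS (generic `E/F`, `N = 1`)

Cell `hodgecm-mathlib` FLOOR 0, crux `stmt-HodgeConjecture-24833` (`H413`); booked residual row «U1-DISJOINT» (desk F0P2-plan (g7)
2026-08-31T15:45:07Z, road (T) of F0P2-p01 (g7) 15:44:49Z), step (6) dealt to this seat by the K1 lead B-p18 (g28) 15:55:29Z («(γ) = GO»).
THEOREMS ONLY (kernel lane, `--supports stmt-HodgeConjecture-24833 --as helper`); no `def`, no instance, no notation, no placeholder.  The CM heads
(`hDich_of_disjoint`, `u1ThetaDichotomy_nonsplit_of_disjoint`) are in the sequel `Theorems/F0P2oU1DichotomyOfDisjoint.lean`.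

WHAT IS PROVED (for a quadratic `E/F`, `c`, a trace-zero `δ` with `δ² = d`, a hermitian line `J_V = T_V ⊗ 1`, a finite place `v`):
* §1 the `1 × 1` dictionary: the local centres (★ `localCenter`) of two hermitian lines are mutually inverse bijections `U(J)(F_v) ⇄ U(J′)(F_v)` that
  do not move matrices or determinants (`localCenter_localCenter_one`, `localDet_localPiEquiv_localCenter_one`); a `1 × 1` unitary matrix is the
  norm-one scalar of its determinant (`localUnitScalar_localDet`, ★ `localUnitScalar`); weight spaces along an onto homomorphism
  (`weightSpace_comp_eq_of_surjective`);
* §2 `hilbertSymbol_eq_neg_one_of_not_isNorm`: a non-norm `t` from `E_v` has `(d, t)_v = −1` [O'Meara 63:10]; and THE DICTIONARY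
  `weightSpace_omegaLoc_localCenter_eq`: for a splitting family `𝓢` of the pair `(J_V, (a))` (★ `FinLocalSplittings` at `Equiv.prodUnique`), the
  `ψ ∘ det`-weight space of `ω_𝓢 ∘ (centre of the (a)-member)` — the letter's reading ★ `OccursInLineWeilCM` — IS the `ψ ∘ det`-weight space of
  the `e′_a`-transported δ-model `ω_{s_a}` on `U(J_V)(F_v)` (★ `lineTransportSection`, MVW II.1 «changement de modèle», `ω_{s_a} = ω_𝓢 ∘ (k ↦ k ⊗ 1)`
  on the nose ★ `omega_lineTransportSection_finLocalSplittings`);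
* §3 `finrank_weightSpace_add_eq_one_of_disjoint`: at a non-split `v`, for two families at `a₁`, `a₂` with `(d, a₂a₁⁻¹)_v = −1`, ★
  `rankOne_theta_dichotomy` [MoeglinVignerasWaldspurger1987, Chap. 3 §IV.4] gives `dim ω_{s₁}[ξ] + dim ω_{s₂}[ξθ] = 1` for an open-kernel `θ`, and
  F0P2-p01's ★ `finrank_weightSpace_add_eq_one_of_shift_of_disjoint` removes `θ` under disjointness (every open-kernel `ξ` of the compact torus
  `U(J_V)(F_v) = E¹_v`, ★ `compactSpace_localPi_rankOne`, is `ψ ∘ det` for a continuous `ψ` of `E¹_v`, §1): `dim ω_{s₁}[ψ∘det] + dim ω_{s₂}[ψ∘det] = 1`.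
HC_CM is proved only modulo the 2 remaining named inputs (hLiu418, h413) — behind them the booked printed statements + the MOD package — until rung 0
closes; this file discharges none of them.

## References
* [MoeglinVignerasWaldspurger1987] C. Mœglin, M.-F. Vignéras, J.-L. Waldspurger, LNM 1291 (1987): Chap. 2 II.1 (models), Chap. 3 §IV.4 (dichotomy).
* [HarrisKudlaSweet1996] M. Harris, S. Kudla, W. Sweet, JAMS 9 (1996): Cor. 4.4 p. 962 (m = n = 1).
* [GelbartRogawski1991] S. Gelbart, J. Rogawski, Invent. Math. 105 (1991): §3.1 p. 454–455, Remark p. 466.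
* [Omeara1963] O. T. O'Meara, *Introduction to quadratic forms*: §63B (63:10).  [Rogawski1990] Ann. of Math. Stud. 123: §3.13 (`det`).
* [Mok2014] C. P. Mok, Mem. AMS 235 (2015): §1 Notation p. 5 (the centre `E¹`).  [BernsteinZelevinsky1976] §2.1 (open kernels).
-/

set_option autoImplicit false
-- the mandated namespace has the single-problem summit's repeated segment (`HodgeConjecture.HodgeConjecture`)
set_option linter.dupNamespace false

noncomputable section

open NumberField IsDedekindDomain MeasureTheory
open scoped Matrix Kronecker

open Literature.NumberTheory Literature.NumberTheory.Automorphic Literature.NumberTheory.Automorphic.UnitaryGroup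
open Literature.NumberTheory.Automorphic.IdeleClassGroup
open Literature.NumberTheory.Automorphic.Liu2021 Literature.NumberTheory.Automorphic.Liu2021.Def411WeilCarriers
open Literature.NumberTheory.Rogawski1990
open Literature.NumberTheory.GelbartRogawski1991 Literature.NumberTheory.GelbartRogawski1991.UnitaryDualPair
open Literature.NumberTheory.GelbartRogawski1991.UnitaryDualPair.LocalSplitting
open Literature.RepresentationTheory Literature.RepresentationTheory.HeisenbergGroup
open Literature.RepresentationTheory.MoeglinVignerasWaldspurger1987

namespace Summit.HodgeConjecture.HodgeConjecture.Cruxes.H413.F0P2oU1DichotomyTransport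

/-! ## §1 The `1 × 1` dictionary: `U(J)(F_v) = U(J′)(F_v) = E¹_v` for any two hermitian lines, determinants, weight spaces -/

section RankOne

variable {F : Type} [Field F] [NumberField F] (E : Type) [Field E] [NumberField E] [Algebra F E]
  (c : E ≃ₐ[F] E) (v : HeightOneSpectrum (𝓞 F))

omit [NumberField F] in
/-- a `1 × 1` matrix is the scalar matrix of its entry. [folklore] -/
private theorem matrix_fin_one_eq_smul_one {R : Type*} [Semiring R] (M : Matrix (Fin 1) (Fin 1) R) :
    M = M 0 0 • (1 : Matrix (Fin 1) (Fin 1) R) := by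
  ext i j
  obtain rfl : i = 0 := Subsingleton.elim _ _
  obtain rfl : j = 0 := Subsingleton.elim _ _
  rw [Matrix.smul_apply, Matrix.one_apply_eq, smul_eq_mul, mul_one]

omit [NumberField F] in
/-- **For `N = 1` the scalar embedding `(g) ↦ (det g · 1₁)` of ★ `localScalarGL` is the identity.** [cite: Mok2014, §1 Notation p. 5] -/
theorem localScalarGL_one_apply (g : LocalGLPi E 1 v) : localScalarGL E 1 v g = g :=
  funext fun w => Units.ext (by rw [coe_localScalarGL_apply]; exact (matrix_fin_one_eq_smul_one _).symm)

/-- the local centre `U(J′)(F_v) → U(J)(F_v)` of two hermitian LINES does not move the underlying matrices. [cite: Mok2014, §1 Notation p. 5] -/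
theorem coe_localCenter_one (J J' : Matrix (Fin 1) (Fin 1) E) (hJ' : J' 0 0 ≠ 0) (z : localPi E c 1 J' v) :
    ((localCenter E c 1 J J' hJ' v z : localPi E c 1 J v) : LocalGLPi E 1 v) = (z : LocalGLPi E 1 v) := by
  rw [coe_localCenter, localScalarGL_one_apply]

/-- **the local centres of two hermitian lines are mutually inverse**: `U(J)(F_v) → U(J′)(F_v) → U(J)(F_v)` is the identity.
[cite: Mok2014, §1 Notation p. 5] -/
theorem localCenter_localCenter_one (J J' : Matrix (Fin 1) (Fin 1) E) (hJ : J 0 0 ≠ 0) (hJ' : J' 0 0 ≠ 0) (k : localPi E c 1 J v) :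
    localCenter E c 1 J J' hJ' v (localCenter E c 1 J' J hJ v k) = k :=
  Subtype.ext (by rw [coe_localCenter_one, coe_localCenter_one])

/-- hence the local centre `U(J′)(F_v) → U(J)(F_v)` of two lines is onto. [cite: Mok2014, §1 Notation p. 5] -/
theorem localCenter_one_surjective (J J' : Matrix (Fin 1) (Fin 1) E) (hJ : J 0 0 ≠ 0) (hJ' : J' 0 0 ≠ 0) :
    Function.Surjective (localCenter E c 1 J J' hJ' v) :=
  fun k => ⟨localCenter E c 1 J' J hJ v k, localCenter_localCenter_one E c v J J' hJ hJ' k⟩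

/-- **determinants are unchanged by the local centre of two lines**: `det ((z) read in U(J)) = det z`. [cite: Rogawski1990, §3.13] -/
theorem localDet_localPiEquiv_localCenter_one (J J' : Matrix (Fin 1) (Fin 1) E) (hJ : IsUnit J.det) (hJ'd : IsUnit J'.det) (hJ' : J' 0 0 ≠ 0)
    (z : localPi E c 1 J' v) :
    localDet c v hJ (localPiEquiv E c 1 J v (localCenter E c 1 J J' hJ' v z)) = localDet c v hJ'd (localPiEquiv E c 1 J' v z) := by
  refine Subtype.ext ?_
  rw [coe_localDet, coe_localDet]
  change Matrix.GeneralLinearGroup.det ((localGLPiEquiv E 1 v).symm (localCenter E c 1 J J' hJ' v z : LocalGLPi E 1 v)) =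
    Matrix.GeneralLinearGroup.det ((localGLPiEquiv E 1 v).symm (z : LocalGLPi E 1 v))
  rw [coe_localCenter_one]

/-- `det ∘ (matrix avatar) : U(J)(F_v) →* E¹_v` is continuous. [cite: Rogawski1990, §3.13] -/
theorem continuous_localDet_localPiEquiv {N : ℕ} (J : Matrix (Fin N) (Fin N) E) (hJ : IsUnit J.det) :
    Continuous fun u : localPi E c N J v => localDet c v hJ (localPiEquiv E c N J v u) :=
  (continuous_localDet c v hJ).comp (localPiEquiv E c N J v).continuous

/-- for `g ∈ GL₁`, the scalar matrix of `det g` is `g`. [folklore] -/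
private theorem units_map_scalar_det_fin_one {R : Type*} [CommRing R] (g : GL (Fin 1) R) :
    Units.map (Matrix.scalar (Fin 1) : R →+* Matrix (Fin 1) (Fin 1) R).toMonoidHom (Matrix.GeneralLinearGroup.det g) = g :=
  Units.ext (by
    change Matrix.scalar (Fin 1) ((Matrix.GeneralLinearGroup.det g : Rˣ) : R) = (g : Matrix (Fin 1) (Fin 1) R)
    rw [Matrix.GeneralLinearGroup.val_det_apply, Matrix.det_fin_one, Matrix.scalar_apply, ← Matrix.smul_one_eq_diagonal]
    exact (matrix_fin_one_eq_smul_one _).symm)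

/-- **a `1 × 1` unitary matrix is the norm-one scalar of its determinant**: `(det u) = u` (★ `localUnitScalar`). [cite: Mok2014, §1 Notation p. 5] -/
theorem localUnitScalar_localDet (J : Matrix (Fin 1) (Fin 1) E) (hJ : IsUnit J.det) (u : localPi E c 1 J v) :
    localUnitScalar E c J v ((localDet c v hJ (localPiEquiv E c 1 J v u) : ↥(normOneUnits (conjLocal E c v))) : (UnitaryGroup.LocalRing E v)ˣ)
        (by rw [mul_comm]; exact (mem_normOneUnits_iff _).1 (localDet c v hJ (localPiEquiv E c 1 J v u)).2) = u := by
  refine Subtype.ext ?_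
  change localGLPiEquiv E 1 v (Units.map (Matrix.scalar (Fin 1) : UnitaryGroup.LocalRing E v →+* _).toMonoidHom
      (Matrix.GeneralLinearGroup.det ((localGLPiEquiv E 1 v).symm (u : LocalGLPi E 1 v)))) = (u : LocalGLPi E 1 v)
  rw [units_map_scalar_det_fin_one, ContinuousMulEquiv.apply_symm_apply]

/-- **weight spaces along an onto homomorphism**: for `φ : K′ →* K` onto, the `(w ∘ φ)`-weight space of `ρ ∘ φ` IS the `w`-weight space of `ρ`
(same subspace of the representation space). [folklore] -/
theorem weightSpace_comp_eq_of_surjective {K K' V : Type*} [Group K] [Group K'] [AddCommGroup V] [Module ℂ V]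
    (ρ : Representation ℂ K V) (φ : K' →* K) (hφ : Function.Surjective φ) (w : K → ℂ) :
    weightSpace (ρ.comp φ) id (fun k' => w (φ k')) = weightSpace ρ id w := by
  unfold weightSpace
  exact hφ.iInf_comp (fun k => Module.End.eigenspace (ρ k) (w k))

end RankOne

/-! ## §2 The `e′_a`-transported sections of a rank-(1,1) family and the letter's «occurs» predicate -/

section Transport

variable (F E : Type) [Field F] [NumberField F] [Field E] [NumberField E] [Algebra F E] [Algebra.IsQuadraticExtension F E]
  (c : E ≃ₐ[F] E) {δ : E} (hcδ : c δ = -δ) (hδ : δ ≠ 0) {d : F} (hd : δ * δ = algebraMap F E d)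
  (TV : Matrix (Fin 1) (Fin 1) F) (hV : TV.IsSymm) (JV : Matrix (Fin 1) (Fin 1) E) (hJV : JV = TV.map (algebraMap F E))
  (v : HeightOneSpectrum (𝓞 F))

include hcδ hδ hd in
/-- **non-norms have Hilbert symbol `(d, t)_v = −1`**: if `t ∈ Fˣ` is not a norm `z·z̄` from `E_v = F_v(δ)` (`δ² = d`), then `x² − d y² = t` has no
solution in `F_v` (the norm form in the coordinates `z = x + yδ`, ★ `quadraticLocalEquiv`), i.e. `(d, t)_v = −1` [O'Meara 63:10].
[cite: Omeara1963, §63B (63:10)] -/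
theorem hilbertSymbol_eq_neg_one_of_not_isNorm (hE : IsField (UnitaryGroup.LocalRing E v)) {t : F} (ht : t ≠ 0)
    (h : ¬ ∃ z : (UnitaryGroup.LocalRing E v)ˣ, (z : UnitaryGroup.LocalRing E v) * conjLocal E c v z =
      algebraMap E (UnitaryGroup.LocalRing E v) (algebraMap F E t)) :
    QuadraticForms.hilbertSymbol (v.adicCompletion F) ((d : F) : v.adicCompletion F) ((t : F) : v.adicCompletion F) = -1 := by
  haveI : CharZero (v.adicCompletion F) := charZero_of_injective_algebraMap (algebraMap F _).injective
  haveI : NeZero (2 : v.adicCompletion F) := ⟨two_ne_zero⟩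
  have hdF : d ≠ 0 := fun h0 => by
    have h1 := hd
    rw [h0, map_zero, mul_self_eq_zero] at h1
    exact hδ h1
  have hd0 : ((d : F) : v.adicCompletion F) ≠ 0 := (map_ne_zero_iff _ (algebraMap F (v.adicCompletion F)).injective).2 hdF
  have ht0 : ((t : F) : v.adicCompletion F) ≠ 0 := (map_ne_zero_iff _ (algebraMap F (v.adicCompletion F)).injective).2 ht
  rw [← QuadraticForms.hilbertSymbol_ne_one_iff, Ne, QuadraticForms.hilbertSymbol_eq_one_iff_exists_norm hd0 ht0]
  rintro ⟨x, y, hxy⟩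
  apply h
  set z : UnitaryGroup.LocalRing E v := quadraticLocalEquiv E v c hcδ hδ (x, y) with hzdef
  have hΔ : algebraMap E (UnitaryGroup.LocalRing E v) δ * algebraMap E (UnitaryGroup.LocalRing E v) δ =
      toLocalRing E v ((d : F) : v.adicCompletion F) := by
    rw [← map_mul, hd, toLocalRing_coe]
  have hz : z * conjLocal E c v z = algebraMap E (UnitaryGroup.LocalRing E v) (algebraMap F E t) := by
    rw [hzdef, conjLocal_quadraticLocalEquiv, quadraticLocalEquiv_apply, quadraticLocalEquiv_apply]
    dsimp only
    rw [map_neg, ← toLocalRing_coe, ← hxy, map_sub, map_mul, map_pow, map_pow, ← hΔ]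
    ring
  have hz0 : z ≠ 0 := by
    intro h0
    rw [h0, zero_mul, ← toLocalRing_coe, eq_comm, map_eq_zero_iff _ (toLocalRing_injective E v)] at hz
    exact ht0 hz
  obtain ⟨b, hb⟩ := hE.mul_inv_cancel hz0
  exact ⟨⟨z, b, hb, by rw [hE.mul_comm]; exact hb⟩, hz⟩

variable (a : Fˣ)
  (𝓢 : FinLocalSplittings F E c 1 hcδ hδ hd (gram F (Equiv.prodUnique (Fin 1) (Fin 1)) TV (TW F a))
    (isSymm_gram F (Equiv.prodUnique (Fin 1) (Fin 1)) hV (isSymm_TW F a))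
    (reindex_kronecker_eq_gram_map F E (Equiv.prodUnique (Fin 1) (Fin 1)) hJV (JW_eq F E a)))

/-- **THE DICTIONARY (letter side ↔ δ-model side).**  For a splitting family `𝓢` of the rank-(1,1) pair `(J_V, (a))` and a character `ψ` of
`E¹_v`: the `ψ ∘ det`-weight space of `ω_𝓢 ∘ (centre of the (a)-member)` on `U((a))(F_v)` (the letter's reading, ★ `OccursInLineWeilCM`) IS the
`ψ ∘ det`-weight space of the `e′_a`-transported δ-model `ω_{s_a}` on `U(J_V)(F_v)` (★ `lineTransportSection`, `ω_{s_a} = ω_𝓢 ∘ (k ↦ k ⊗ 1)` on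
the nose) — the two `1 × 1` unitary groups are the same torus `E¹_v` (§1). [cite: MoeglinVignerasWaldspurger1987, Chap. 2 II.1; Chap. 3 I.1]
[cite: GelbartRogawski1991, §3.1 p. 454–455] -/
theorem weightSpace_omegaLoc_localCenter_eq (hJVd : IsUnit JV.det) (hJV0 : JV 0 0 ≠ 0) (hJW : IsUnit (JW F E a).det)
    (ψ : ↥(normOneUnits (conjLocal E c v)) →* ℂˣ) :
    weightSpace ((𝓢.omegaLoc v).comp
        (localCenter E c 1 (Matrix.reindex (Equiv.prodUnique (Fin 1) (Fin 1)) (Equiv.prodUnique (Fin 1) (Fin 1)) (JV ⊗ₖ JW F E a))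
          (JW F E a) (JW_apply_ne_zero F E a) v)) id
        (fun u => ((ψ (localDet c v hJW (localPiEquiv E c 1 (JW F E a) v u)) : ℂˣ) : ℂ)) =
      weightSpace ((MpPsi.toRep (localSchrodinger F 1 TV v)).comp
        (lineTransportSection F E c 1 hcδ hδ hd TV hV JV hJV a v (𝓢.s v) (𝓢.proj_s v))) id
        (fun k => ((ψ (localDet c v hJVd (localPiEquiv E c 1 JV v k)) : ℂˣ) : ℂ)) := by
  have hrep : (𝓢.omegaLoc v).comp
        (localCenter E c 1 (Matrix.reindex (Equiv.prodUnique (Fin 1) (Fin 1)) (Equiv.prodUnique (Fin 1) (Fin 1)) (JV ⊗ₖ JW F E a))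
          (JW F E a) (JW_apply_ne_zero F E a) v) =
      ((MpPsi.toRep (localSchrodinger F 1 TV v)).comp
        (lineTransportSection F E c 1 hcδ hδ hd TV hV JV hJV a v (𝓢.s v) (𝓢.proj_s v))).comp
          (localCenter E c 1 JV (JW F E a) (JW_apply_ne_zero F E a) v) := by
    refine MonoidHom.ext fun z => ?_
    change (𝓢.omegaLoc v) (localCenter E c 1 _ (JW F E a) (JW_apply_ne_zero F E a) v z) =
      ((MpPsi.toRep (localSchrodinger F 1 TV v)).comp
        (lineTransportSection F E c 1 hcδ hδ hd TV hV JV hJV a v (𝓢.s v) (𝓢.proj_s v)))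
        (localCenter E c 1 JV (JW F E a) (JW_apply_ne_zero F E a) v z)
    rw [← localLineInl_localCenter E c 1 (Equiv.prodUnique (Fin 1) (Fin 1)) JV (JW F E a) (JW F E a) (JW_apply_ne_zero F E a) v z]
    exact (DFunLike.congr_fun (omega_lineTransportSection_finLocalSplittings F E c 1 hcδ hδ hd TV hV JV hJV a v 𝓢)
      (localCenter E c 1 JV (JW F E a) (JW_apply_ne_zero F E a) v z)).symm
  have hw : (fun u => ((ψ (localDet c v hJW (localPiEquiv E c 1 (JW F E a) v u)) : ℂˣ) : ℂ)) =
      fun u => (fun k => ((ψ (localDet c v hJVd (localPiEquiv E c 1 JV v k)) : ℂˣ) : ℂ))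
        (localCenter E c 1 JV (JW F E a) (JW_apply_ne_zero F E a) v u) := by
    funext u
    dsimp only
    rw [localDet_localPiEquiv_localCenter_one E c v JV (JW F E a) hJVd hJW (JW_apply_ne_zero F E a)]
  rw [hrep, hw]
  exact weightSpace_comp_eq_of_surjective
    ((MpPsi.toRep (localSchrodinger F 1 TV v)).comp (lineTransportSection F E c 1 hcδ hδ hd TV hV JV hJV a v (𝓢.s v) (𝓢.proj_s v)))
    (localCenter E c 1 JV (JW F E a) (JW_apply_ne_zero F E a) v)
    (localCenter_one_surjective E c v JV (JW F E a) hJV0 (JW_apply_ne_zero F E a))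
    (fun k => ((ψ (localDet c v hJVd (localPiEquiv E c 1 JV v k)) : ℂˣ) : ℂ))

end Transport

/-! ## §3 The shifted dichotomy at the transported sections, and the shift removal under disjointness -/

section Dichotomy

variable (F E : Type) [Field F] [NumberField F] [Field E] [NumberField E] [Algebra F E] [Algebra.IsQuadraticExtension F E]
  (c : E ≃ₐ[F] E) {δ : E} (hcδ : c δ = -δ) (hδ : δ ≠ 0) {d : F} (hd : δ * δ = algebraMap F E d)
  (TV : Matrix (Fin 1) (Fin 1) F) (hV : TV.IsSymm) (hVd : IsUnit TV.det) (JV : Matrix (Fin 1) (Fin 1) E)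
  (hJV : JV = TV.map (algebraMap F E)) (hJVd : IsUnit JV.det) (v : HeightOneSpectrum (𝓞 F)) (hE : IsField (UnitaryGroup.LocalRing E v))
  (a₁ a₂ : Fˣ)
  (𝓢₁ : FinLocalSplittings F E c 1 hcδ hδ hd (gram F (Equiv.prodUnique (Fin 1) (Fin 1)) TV (TW F a₁))
    (isSymm_gram F (Equiv.prodUnique (Fin 1) (Fin 1)) hV (isSymm_TW F a₁))
    (reindex_kronecker_eq_gram_map F E (Equiv.prodUnique (Fin 1) (Fin 1)) hJV (JW_eq F E a₁)))
  (𝓢₂ : FinLocalSplittings F E c 1 hcδ hδ hd (gram F (Equiv.prodUnique (Fin 1) (Fin 1)) TV (TW F a₂))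
    (isSymm_gram F (Equiv.prodUnique (Fin 1) (Fin 1)) hV (isSymm_TW F a₂))
    (reindex_kronecker_eq_gram_map F E (Equiv.prodUnique (Fin 1) (Fin 1)) hJV (JW_eq F E a₂)))

include hVd hE in
set_option maxHeartbeats 1600000 in -- MEASURED: the statement alone (six δ-model carriers) + MVW's 30-argument instantiation exceed 200 k
/-- **THE EXACT DICHOTOMY AT THE TRANSPORTED SECTIONS, FROM DISJOINTNESS.**  For two splitting families `𝓢₁, 𝓢₂` of the pairs `(J_V, (a₁))`,
`(J_V, (a₂))` with `(d, a₂a₁⁻¹)_v = −1` (lines in different classes) at a non-split `v`, and their `e′_a`-transported δ-model carriers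
`ω_{s₁}, ω_{s₂}` on the compact torus `U(J_V)(F_v) = E¹_v`: if for every continuous `ψ` of `E¹_v` at most one of the `ψ ∘ det`-weight spaces is
non-zero, then EXACTLY one is, and it is a line: `dim ω_{s₁}[ψ∘det] + dim ω_{s₂}[ψ∘det] = 1`.  (★ `rankOne_theta_dichotomy` gives the SHIFTED form
`dim ω_{s₁}[ξ] + dim ω_{s₂}[ξθ] = 1`; p01's ★ `finrank_weightSpace_add_eq_one_of_shift_of_disjoint` removes `θ`; every open-kernel `ξ` is `ψ ∘ det`.)
[cite: MoeglinVignerasWaldspurger1987, Chap. 3 §IV.4 Théorème principal] [cite: HarrisKudlaSweet1996, Cor. 4.4 p. 962] -/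
theorem finrank_weightSpace_add_eq_one_of_disjoint
    (hcls : QuadraticForms.hilbertSymbol (v.adicCompletion F) ((d : F) : v.adicCompletion F)
      (((a₂ * a₁⁻¹ : Fˣ) : F) : v.adicCompletion F) = -1)
    (hdisj : ∀ ψ : ↥(normOneUnits (conjLocal E c v)) →* ℂˣ, (Continuous fun β => ((ψ β : ℂˣ) : ℂ)) →
      weightSpace ((MpPsi.toRep (localSchrodinger F 1 TV v)).comp
          (lineTransportSection F E c 1 hcδ hδ hd TV hV JV hJV a₁ v (𝓢₁.s v) (𝓢₁.proj_s v))) id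
          (fun k => ((ψ (localDet c v hJVd (localPiEquiv E c 1 JV v k)) : ℂˣ) : ℂ)) = ⊥ ∨
        weightSpace ((MpPsi.toRep (localSchrodinger F 1 TV v)).comp
          (lineTransportSection F E c 1 hcδ hδ hd TV hV JV hJV a₂ v (𝓢₂.s v) (𝓢₂.proj_s v))) id
          (fun k => ((ψ (localDet c v hJVd (localPiEquiv E c 1 JV v k)) : ℂˣ) : ℂ)) = ⊥)
    (ψ : ↥(normOneUnits (conjLocal E c v)) →* ℂˣ) (hψ : Continuous fun β => ((ψ β : ℂˣ) : ℂ)) :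
    Module.finrank ℂ (weightSpace ((MpPsi.toRep (localSchrodinger F 1 TV v)).comp
          (lineTransportSection F E c 1 hcδ hδ hd TV hV JV hJV a₁ v (𝓢₁.s v) (𝓢₁.proj_s v))) id
          (fun k => ((ψ (localDet c v hJVd (localPiEquiv E c 1 JV v k)) : ℂˣ) : ℂ))) +
      Module.finrank ℂ (weightSpace ((MpPsi.toRep (localSchrodinger F 1 TV v)).comp
          (lineTransportSection F E c 1 hcδ hδ hd TV hV JV hJV a₂ v (𝓢₂.s v) (𝓢₂.proj_s v))) id
          (fun k => ((ψ (localDet c v hJVd (localPiEquiv E c 1 JV v k)) : ℂˣ) : ℂ))) = 1 := by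
  classical
  haveI : CharZero (v.adicCompletion F) := charZero_of_injective_algebraMap (algebraMap F _).injective
  -- the torus `K = U(J_V)(F_v)` is compact
  haveI : CompactSpace (localPi E c 1 JV v) := compactSpace_localPi_rankOne F E c hcδ hδ hVd hJV v hE
  -- the determinant `K →* E¹_v` (an opaque name with its defining equation) and its characters
  obtain ⟨detK, hdetK⟩ : ∃ f : localPi E c 1 JV v →* ↥(normOneUnits (conjLocal E c v)),
      ∀ k, f k = localDet c v hJVd (localPiEquiv E c 1 JV v k) :=
    ⟨(localDet c v hJVd).comp (localPiEquiv E c 1 JV v).toMonoidHom, fun _ => rfl⟩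
  -- the class sign in MVW's currency: `(α, d₁)_v = -1` with `δ₁ = a₁⁻¹δ`, `δ₂ = a₂⁻¹δ = α δ₁`, `α = a₂⁻¹a₁`, `d₁ = a₁⁻²d`
  have ha₁ : ((a₁ : F) : v.adicCompletion F) ≠ 0 := (map_ne_zero_iff _ (algebraMap F (v.adicCompletion F)).injective).2 a₁.ne_zero
  have ha₂ : ((a₂ : F) : v.adicCompletion F) ≠ 0 := (map_ne_zero_iff _ (algebraMap F (v.adicCompletion F)).injective).2 a₂.ne_zero
  have hα0 : ((a₂⁻¹ * a₁ : Fˣ) : F) ≠ 0 := (a₂⁻¹ * a₁).ne_zero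
  have hα : algebraMap F E (↑a₂⁻¹ : F) * δ = algebraMap F E ((a₂⁻¹ * a₁ : Fˣ) : F) * (algebraMap F E (↑a₁⁻¹ : F) * δ) := by
    rw [← mul_assoc, ← map_mul, Units.val_mul, mul_assoc, ← Units.val_mul, mul_inv_cancel, Units.val_one, mul_one]
  have hclass : QuadraticForms.hilbertSymbol (v.adicCompletion F) ((((a₂⁻¹ * a₁ : Fˣ) : F)) : v.adicCompletion F)
      (((↑a₁⁻¹ * ↑a₁⁻¹ * d : F)) : v.adicCompletion F) = -1 := by
    have hc2 : ((((a₂⁻¹ * a₁ : Fˣ) : F)) : v.adicCompletion F) ≠ 0 :=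
      (map_ne_zero_iff _ (algebraMap F (v.adicCompletion F)).injective).2 hα0
    have e1 : (((↑a₁⁻¹ * ↑a₁⁻¹ * d : F)) : v.adicCompletion F) =
        ((d : F) : v.adicCompletion F) * ((((a₁ : F) : v.adicCompletion F))⁻¹) ^ 2 := by
      change algebraMap F (v.adicCompletion F) (↑a₁⁻¹ * ↑a₁⁻¹ * d) =
        algebraMap F (v.adicCompletion F) d * (algebraMap F (v.adicCompletion F) (a₁ : F))⁻¹ ^ 2
      rw [map_mul, map_mul, Units.val_inv_eq_inv_val, map_inv₀]; ring
    have e2 : ((((a₂⁻¹ * a₁ : Fˣ) : F)) : v.adicCompletion F) =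
        (((a₂ * a₁⁻¹ : Fˣ) : F) : v.adicCompletion F) * (((((a₂⁻¹ * a₁ : Fˣ) : F)) : v.adicCompletion F)) ^ 2 := by
      change algebraMap F (v.adicCompletion F) ((a₂⁻¹ * a₁ : Fˣ) : F) =
        algebraMap F (v.adicCompletion F) ((a₂ * a₁⁻¹ : Fˣ) : F) * (algebraMap F (v.adicCompletion F) ((a₂⁻¹ * a₁ : Fˣ) : F)) ^ 2
      have ha₁' : algebraMap F (v.adicCompletion F) (a₁ : F) ≠ 0 := ha₁
      have ha₂' : algebraMap F (v.adicCompletion F) (a₂ : F) ≠ 0 := ha₂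
      rw [Units.val_mul, Units.val_mul, Units.val_inv_eq_inv_val, Units.val_inv_eq_inv_val, map_mul, map_mul, map_inv₀, map_inv₀]
      field_simp
    rw [e1, Weil1964.hilbertSymbol_mul_sq_right _ _ (inv_ne_zero ha₁), QuadraticForms.hilbertSymbol_comm, e2,
      Weil1964.hilbertSymbol_mul_sq_right _ _ hc2]
    exact hcls
  -- MVW's shifted dichotomy (Haar measure and conductor exponent of `ψ_v` supplied locally, for the explicit formulas behind it)
  obtain ⟨θ, hθo, hshift⟩ := by
    letI : MeasurableSpace (v.adicCompletion F) := borel _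
    haveI : BorelSpace (v.adicCompletion F) := ⟨rfl⟩
    exact rankOne_theta_dichotomy F E c (algebraMap F E (↑a₁⁻¹ : F) * δ) (conj_lineDelta hcδ a₁)
      (lineDelta_ne_zero hδ a₁) (↑a₁⁻¹ * ↑a₁⁻¹ * d) (lineDelta_mul_self hd a₁) (algebraMap F E (↑a₂⁻¹ : F) * δ) (conj_lineDelta hcδ a₂)
      (lineDelta_ne_zero hδ a₂) (↑a₂⁻¹ * ↑a₂⁻¹ * d) (lineDelta_mul_self hd a₂) ((a₂⁻¹ * a₁ : Fˣ) : F) hα0 hα TV hV hVd JV hJV v hE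
      (lineTransportSection F E c 1 hcδ hδ hd TV hV JV hJV a₁ v (𝓢₁.s v) (𝓢₁.proj_s v)) (proj_lineTransportSection F E c 1 hcδ hδ hd TV hV JV hJV a₁ v (𝓢₁.s v) (𝓢₁.proj_s v))
      (isSmooth_lineTransportSection F E c 1 hcδ hδ hd TV hV JV hJV a₁ v (𝓢₁.s v) (𝓢₁.proj_s v) (𝓢₁.smooth v))
      (lineTransportSection F E c 1 hcδ hδ hd TV hV JV hJV a₂ v (𝓢₂.s v) (𝓢₂.proj_s v)) (proj_lineTransportSection F E c 1 hcδ hδ hd TV hV JV hJV a₂ v (𝓢₂.s v) (𝓢₂.proj_s v))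
      (isSmooth_lineTransportSection F E c 1 hcδ hδ hd TV hV JV hJV a₂ v (𝓢₂.s v) (𝓢₂.proj_s v) (𝓢₂.smooth v))
      (Measure.addHaar : Measure (v.adicCompletion F)) _
        (isContinuousNontrivial_adeleAddCharAt F v).exists_hasConductorExp.choose_spec hclass
  -- the norm-one scalar section `E¹_v →* K` (opaque name with its defining equation), a two-sided inverse of `det`
  have hσmul : ∀ β γ : ↥(normOneUnits (conjLocal E c v)),
      localUnitScalar E c JV v ((β * γ : ↥(normOneUnits (conjLocal E c v))) : (UnitaryGroup.LocalRing E v)ˣ)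
          (by rw [mul_comm]; exact (mem_normOneUnits_iff _).1 (β * γ).2) =
        localUnitScalar E c JV v (β : (UnitaryGroup.LocalRing E v)ˣ) (by rw [mul_comm]; exact (mem_normOneUnits_iff _).1 β.2) *
          localUnitScalar E c JV v (γ : (UnitaryGroup.LocalRing E v)ˣ) (by rw [mul_comm]; exact (mem_normOneUnits_iff _).1 γ.2) := by
    intro β γ
    refine Subtype.ext ?_
    change localGLPiEquiv E 1 v (Units.map (Matrix.scalar (Fin 1) : UnitaryGroup.LocalRing E v →+* _).toMonoidHom
        ((β : (UnitaryGroup.LocalRing E v)ˣ) * γ)) =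
      localGLPiEquiv E 1 v (Units.map (Matrix.scalar (Fin 1) : UnitaryGroup.LocalRing E v →+* _).toMonoidHom (β : (UnitaryGroup.LocalRing E v)ˣ)) *
        localGLPiEquiv E 1 v (Units.map (Matrix.scalar (Fin 1) : UnitaryGroup.LocalRing E v →+* _).toMonoidHom (γ : (UnitaryGroup.LocalRing E v)ˣ))
    rw [← map_mul, ← map_mul]
  obtain ⟨σ, hσ⟩ : ∃ σ : ↥(normOneUnits (conjLocal E c v)) →* localPi E c 1 JV v, ∀ β, σ β =
      localUnitScalar E c JV v (β : (UnitaryGroup.LocalRing E v)ˣ) (by rw [mul_comm]; exact (mem_normOneUnits_iff _).1 β.2) :=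
    ⟨{ toFun := fun β : ↥(normOneUnits (conjLocal E c v)) => localUnitScalar E c JV v (β : (UnitaryGroup.LocalRing E v)ˣ)
          (by rw [mul_comm]; exact (mem_normOneUnits_iff _).1 β.2),
       map_one' := by
          refine Subtype.ext ?_
          change localGLPiEquiv E 1 v (Units.map (Matrix.scalar (Fin 1) : UnitaryGroup.LocalRing E v →+* _).toMonoidHom 1) = 1
          rw [map_one, map_one],
       map_mul' := hσmul }, fun _ => rfl⟩
  have hσc : Continuous σ := by
    have e : (σ : ↥(normOneUnits (conjLocal E c v)) → localPi E c 1 JV v) = fun β : ↥(normOneUnits (conjLocal E c v)) =>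
        localUnitScalar E c JV v (β : (UnitaryGroup.LocalRing E v)ˣ) (by rw [mul_comm]; exact (mem_normOneUnits_iff _).1 β.2) := funext hσ
    rw [e]
    exact F0P2oK1occ.continuous_localUnitScalar_normOneUnits E c JV v
  have hσdet : ∀ k : localPi E c 1 JV v, σ (localDet c v hJVd (localPiEquiv E c 1 JV v k)) = k := fun k => by
    rw [hσ]; exact localUnitScalar_localDet E c v JV hJVd k
  have hdisj' : ∀ ξ : localPi E c 1 JV v →* ℂˣ, IsOpen (ξ.ker : Set (localPi E c 1 JV v)) →
      Module.finrank ℂ (weightSpace ((MpPsi.toRep (localSchrodinger F 1 TV v)).comp (lineTransportSection F E c 1 hcδ hδ hd TV hV JV hJV a₁ v (𝓢₁.s v) (𝓢₁.proj_s v))) id (fun k => ((ξ k : ℂˣ) : ℂ))) = 0 ∨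
        Module.finrank ℂ (weightSpace ((MpPsi.toRep (localSchrodinger F 1 TV v)).comp (lineTransportSection F E c 1 hcδ hδ hd TV hV JV hJV a₂ v (𝓢₂.s v) (𝓢₂.proj_s v))) id (fun k => ((ξ k : ℂˣ) : ℂ))) = 0 := by
    intro ξ hξ
    have hξc := continuous_apply_of_isOpen_ker_rankOne F E c hVd hJV v ξ hξ
    have hψ' : Continuous fun β => (((ξ.comp σ) β : ℂˣ) : ℂ) := hξc.comp hσc
    have hfun : (fun k => ((ξ k : ℂˣ) : ℂ)) = fun k => (((ξ.comp σ) (localDet c v hJVd (localPiEquiv E c 1 JV v k)) : ℂˣ) : ℂ) := by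
      funext k
      rw [MonoidHom.comp_apply, hσdet]
    rw [hfun]
    rcases hdisj (ξ.comp σ) hψ' with h0 | h0
    · exact Or.inl (by rw [h0, finrank_bot])
    · exact Or.inr (by rw [h0, finrank_bot])
  -- the character `ψ ∘ det` of `K` has open kernel; conclude by the shift removal
  have hfunψ : (fun k => ((ψ (localDet c v hJVd (localPiEquiv E c 1 JV v k)) : ℂˣ) : ℂ)) = fun k => (((ψ.comp detK) k : ℂˣ) : ℂ) :=
    funext fun k => by rw [MonoidHom.comp_apply, hdetK]
  have hξo : IsOpen (((ψ.comp detK).ker : Subgroup (localPi E c 1 JV v)) : Set (localPi E c 1 JV v)) := by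
    refine isOpen_ker_rankOne F E c hcδ hδ hVd hJV v hE (ψ.comp detK) ?_
    rw [← hfunψ]
    exact hψ.comp (continuous_localDet_localPiEquiv E c v JV hJVd)
  rw [hfunψ]
  exact TwistedCoinv.finrank_weightSpace_add_eq_one_of_shift_of_disjoint _ _ θ hθo hshift hdisj' (ψ.comp detK) hξo

end Dichotomy

end Summit.HodgeConjecture.HodgeConjecture.Cruxes.H413.F0P2oU1DichotomyTransport

end
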